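import Mathlib
import Literature.AlgebraicGeometry.HyperbolicPolynomials.HyperbolicityCone
import Literature.AlgebraicGeometry.HyperbolicPolynomials.SmoothBoundary
import Summits.ValiantsHypothesis.ValiantsHypothesis.Theorems.PermanentalConesPermanentalConeHardGardingGradient
import Summits.ValiantsHypothesis.ValiantsHypothesis.Theorems.PermanentalConesPermanentalConeHardSlackAsPermanent
import Summits.ValiantsHypothesis.ValiantsHypothesis.Theorems.PermanentalConesPermanentalHyperbolic

/-!
# `PermanentalConeHard` (stmt-ValiantsHypothesis-8654), line `birth` — orthant rows factor with size `n`

Route `PermanentalCones` of `ValiantsHypothesis`, crux `PermanentalConeHard` (H+), core stub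
`stub_permanentalGradientPsdRank`: the gradient slack matrices
`S[i,k] = gradForm Q_n (z_k) (x_i) = ⟨∇Q_n(z_k), x_i⟩` of a nonnegative permanental family
`Q_n = per[(Y_n)_{rows<r n}; x^{(n-r n)}]` (row points `x_i`, column points `z_k` in the closed cone
`Λ₊(Q_n, 𝟙)`) should have psd-rank exceeding every `m ≤ 2^((log₂ n + c)^c)`.

This file records a STRUCTURAL NEGATIVE fact constraining every attack on the core stub
(`stub_orthantRowsFactorSizeN`): row points in the nonnegative orthant never certify psd-rank `> n`.

* (A) `stub_orthantRowsFactorSizeN` — for a form `P` hyperbolic w.r.t. `𝟙` with `P(𝟙) > 0` whose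
  closed cone contains the coordinate vectors `e_j`, every partial `∂ⱼP(z) = ⟨∇P(z), e_j⟩` is `≥ 0`
  at cone points `z` (Gårding's dual-cone lemma `stub_gardingGradient`); hence for rows `x_i ≥ 0`
  the slack matrix factors DIAGONALLY with size `n`:
  `U i := diagonal (x_i) ⪰ 0`, `V k := diagonal (∇P(z_k)) ⪰ 0`,
  `tr (U i * V k) = Σⱼ (x_i)ⱼ ∂ⱼP(z_k) = ⟨∇P(z_k), x_i⟩`.
* (B) `permanental_orthantRows_factor` — the same for every nonnegative permanental cone
  (`Y ≥ 0`, `Q(𝟙) > 0`): the orthant, in particular every `e_j`, lies in `Λ₊(Q, 𝟙)`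
  (`mem_hyperbolicityCone_rowPermanent_of_nonneg`), `Q` is homogeneous
  (`isHomogeneous_rowPermanent`) and hyperbolic w.r.t. `𝟙` (`permanentalHyperbolic_proof`).
* (C) `permanental_levelOne_rows_not_all_nonneg` — consequently (with the zero-padding
  `psdFactor_mono` of psd factorisations to any larger size `m ≥ n`) a witness `(x_i), (z_k)` of
  "no psd factorisation of size `m`" for some `m ≥ n` — as the levels `c ≥ 1` of the core stub
  demand, since `2^((log₂ n + c)^c) > n` there — must use a row point with a NEGATIVE coordinate:
  Boolean / orthant row points settle level `c = 0` only.

References: L. Gårding, *An inequality for hyperbolic polynomials*, J. Math. Mech. 8 (1959)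
957–965 (dual cone); H. Fawzi, J. Gouveia, P. Parrilo, R. Robinson, R. Thomas, *Positive
semidefinite rank*, Math. Program. 153 (2015), §2 (padding / monotonicity of psd factorisations);
everything here is elementary and proved in full.
-/

set_option linter.dupNamespace false

noncomputable section

namespace Summit.ValiantsHypothesis.ValiantsHypothesis.Theorems.PermanentalConesPermanentalConeHard

open MvPolynomial Finset
open scoped BigOperators Matrix
open Literature.AlgebraicGeometry.HyperbolicPolynomials

namespace OrthantRowsFactor

/-- Unfolding the gradient pairing: `⟨∇P(z), x⟩ = Σⱼ xⱼ ∂ⱼP(z)`. [folklore] -/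
theorem gradForm_eq_sum {n : ℕ} (P : MvPolynomial (Fin n) ℝ) (z x : Fin n → ℝ) :
    gradForm P z x = ∑ j, x j * MvPolynomial.eval z (pderiv j P) :=
  rfl

/-- The partials are gradient pairings against the coordinate vectors:
`∂ⱼP(z) = ⟨∇P(z), e_j⟩`. [folklore] -/
theorem eval_pderiv_eq_gradForm_single {n : ℕ} (P : MvPolynomial (Fin n) ℝ) (z : Fin n → ℝ)
    (j : Fin n) :
    MvPolynomial.eval z (pderiv j P) = gradForm P z (Pi.single j 1) := by
  rw [gradForm_eq_sum, Finset.sum_eq_single j]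
  · rw [Pi.single_eq_same, one_mul]
  · intro b _ hb
    rw [Pi.single_eq_of_ne hb, zero_mul]
  · intro h
    exact absurd (Finset.mem_univ j) h

/-- **Gårding sign of the partials.** If the coordinate vector `e_j` lies in the closed cone
`Λ₊(P, 𝟙)` of a form `P` hyperbolic w.r.t. `𝟙` with `P(𝟙) > 0`, then `∂ⱼP(z) ≥ 0` at every cone
point `z` (`stub_gardingGradient` with `x := e_j`). [folklore] -/
theorem eval_pderiv_nonneg_of_single_mem {n d : ℕ} {P : MvPolynomial (Fin n) ℝ}
    (hP : P.IsHomogeneous d) (he : IsHyperbolic P (fun _ => (1 : ℝ)))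
    (hpos : 0 < MvPolynomial.eval (fun _ => (1 : ℝ)) P) {j : Fin n}
    (hj : (Pi.single j (1 : ℝ) : Fin n → ℝ) ∈ hyperbolicityCone P (fun _ => (1 : ℝ)))
    {z : Fin n → ℝ} (hz : z ∈ hyperbolicityCone P (fun _ => (1 : ℝ))) :
    0 ≤ MvPolynomial.eval z (pderiv j P) := by
  rw [eval_pderiv_eq_gradForm_single]
  exact stub_gardingGradient n d P _ hP he hpos z hz _ hj

/-- `tr (diagonal a * diagonal b) = Σⱼ aⱼ bⱼ`. [folklore] -/
theorem trace_diagonal_mul_diagonal {n : ℕ} (a b : Fin n → ℝ) :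
    Matrix.trace (Matrix.diagonal a * Matrix.diagonal b) = ∑ j, a j * b j := by
  rw [Matrix.diagonal_mul_diagonal, Matrix.trace_diagonal]

/-- `Sᵀ S = 1` for the `0/1` selection matrix `S a j = [a = j]` of the (injective) initial-segment
embedding `Fin n ↪ Fin m` (`n ≤ m`). [folklore] -/
theorem selMatrix_transpose_mul_self {n m : ℕ} (h : n ≤ m) :
    (Matrix.of fun (a : Fin m) (j : Fin n) => if a = Fin.castLE h j then (1 : ℝ) else 0)ᵀ *
        Matrix.of (fun (a : Fin m) (j : Fin n) => if a = Fin.castLE h j then (1 : ℝ) else 0) =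
      1 := by
  ext a b
  simp only [Matrix.mul_apply, Matrix.transpose_apply, Matrix.of_apply, ite_mul, one_mul,
    zero_mul, Finset.sum_ite_eq', Finset.mem_univ, if_true, Matrix.one_apply,
    (Fin.castLE_injective h).eq_iff]

/-- **Monotonicity of psd factorisations in the size** (zero-padding `M ↦ S M Sᵀ` along the
initial-segment embedding, `S` its selection matrix): a psd factorisation of size `n` of a matrix
`(M i k)` yields one of every size `m ≥ n`. [folklore] -/
theorem psdFactor_mono {ι κ : Type*} {M : ι → κ → ℝ} {n m : ℕ} (hnm : n ≤ m)
    (h : ∃ (U : ι → Matrix (Fin n) (Fin n) ℝ) (V : κ → Matrix (Fin n) (Fin n) ℝ),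
      (∀ i, (U i).PosSemidef) ∧ (∀ k, (V k).PosSemidef) ∧
        ∀ i k, M i k = Matrix.trace (U i * V k)) :
    ∃ (U : ι → Matrix (Fin m) (Fin m) ℝ) (V : κ → Matrix (Fin m) (Fin m) ℝ),
      (∀ i, (U i).PosSemidef) ∧ (∀ k, (V k).PosSemidef) ∧
        ∀ i k, M i k = Matrix.trace (U i * V k) := by
  obtain ⟨U, V, hU, hV, hM⟩ := h
  -- the selection matrix of `Fin.castLE hnm : Fin n → Fin m`
  set S : Matrix (Fin m) (Fin n) ℝ :=
    Matrix.of fun (a : Fin m) (j : Fin n) => if a = Fin.castLE hnm j then (1 : ℝ) else 0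
  have hSS : Sᵀ * S = 1 := selMatrix_transpose_mul_self hnm
  refine ⟨fun i => S * U i * Sᵀ, fun k => S * V k * Sᵀ, fun i => ?_, fun k => ?_, fun i k => ?_⟩
  · simpa only [Matrix.conjTranspose_eq_transpose_of_trivial] using
      (hU i).mul_mul_conjTranspose_same S
  · simpa only [Matrix.conjTranspose_eq_transpose_of_trivial] using
      (hV k).mul_mul_conjTranspose_same S
  · rw [hM i k]
    symm
    calc Matrix.trace (S * U i * Sᵀ * (S * V k * Sᵀ))
        = Matrix.trace (S * U i * (Sᵀ * S) * V k * Sᵀ) := by simp only [Matrix.mul_assoc]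
      _ = Matrix.trace (U i * V k) := by
          rw [hSS, Matrix.mul_one, Matrix.mul_assoc S, Matrix.trace_mul_cycle, hSS, Matrix.one_mul]

end OrthantRowsFactor

open OrthantRowsFactor

/-- **Orthant rows factor with size `n`** (registered stub `stub_orthantRowsFactorSizeN`).  For a
form `P` hyperbolic w.r.t. `𝟙` with `P(𝟙) > 0` whose closed cone `Λ₊(P, 𝟙)` contains the coordinate
vectors `e_j`, row points `x_i ≥ 0` and cone points `z_k`, the gradient slack matrix
`⟨∇P(z_k), x_i⟩` has the DIAGONAL psd factorisation of size `n`
`U i := diagonal (x_i)`, `V k := diagonal (∇P(z_k))` (`∇P(z_k) ≥ 0` by Gårding's dual-cone lemma,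
`eval_pderiv_nonneg_of_single_mem`), `tr (U i * V k) = Σⱼ (x_i)ⱼ ∂ⱼP(z_k) = ⟨∇P(z_k), x_i⟩`.
Hence orthant (e.g. Boolean) row points never certify psd-rank `> n`. [folklore] -/
theorem stub_orthantRowsFactorSizeN : ∀ (n d : ℕ) (P : MvPolynomial (Fin n) ℝ), P.IsHomogeneous d → IsHyperbolic P (fun _ => (1 : ℝ)) → 0 < MvPolynomial.eval (fun _ => (1 : ℝ)) P → (∀ j : Fin n, (Pi.single j (1 : ℝ) : Fin n → ℝ) ∈ hyperbolicityCone P (fun _ => (1 : ℝ))) → ∀ (ι κ : Type) (xs : ι → Fin n → ℝ) (zs : κ → Fin n → ℝ), (∀ i j, 0 ≤ xs i j) → (∀ k, zs k ∈ hyperbolicityCone P (fun _ => (1 : ℝ))) → ∃ (U : ι → Matrix (Fin n) (Fin n) ℝ) (V : κ → Matrix (Fin n) (Fin n) ℝ), (∀ i, (U i).PosSemidef) ∧ (∀ k, (V k).PosSemidef) ∧ ∀ i k, gradForm P (zs k) (xs i) = Matrix.trace (U i * V k) := by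
  intro n d P hP he hpos hej ι κ xs zs hxs hzs
  refine ⟨fun i => Matrix.diagonal (xs i),
    fun k => Matrix.diagonal fun j => MvPolynomial.eval (zs k) (pderiv j P),
    fun i => Matrix.PosSemidef.diagonal fun j => hxs i j,
    fun k => Matrix.PosSemidef.diagonal fun j =>
      eval_pderiv_nonneg_of_single_mem hP he hpos (hej j) (hzs k),
    fun i k => ?_⟩
  rw [trace_diagonal_mul_diagonal, gradForm_eq_sum]

/-- **Orthant rows factor with size `n`, permanental cones.**  For an entrywise nonnegative `Y` and
`P = per[(Y)_{rows<r}; s^{(n-r)}]` with `P(𝟙) > 0`, row points `x_i ≥ 0` and cone points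
`z_k ∈ Λ₊(P, 𝟙)`, the gradient slack matrix `⟨∇P(z_k), x_i⟩` has a psd factorisation of size `n`:
`stub_orthantRowsFactorSizeN`, whose hypotheses hold since `P` is homogeneous
(`isHomogeneous_rowPermanent`), hyperbolic w.r.t. `𝟙` (`permanentalHyperbolic_proof`), and every
`e_j ≥ 0` lies in its cone (`mem_hyperbolicityCone_rowPermanent_of_nonneg`). [folklore] -/
theorem permanental_orthantRows_factor :
    ∀ (n r : ℕ) (Y : Matrix (Fin n) (Fin n) ℝ), (∀ i j, 0 ≤ Y i j) →
      ∀ P : MvPolynomial (Fin n) ℝ, P = (Matrix.of fun i j : Fin n =>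
        if (i : ℕ) < r then MvPolynomial.C (Y i j) else MvPolynomial.X j).permanent →
      0 < MvPolynomial.eval (fun _ => (1 : ℝ)) P →
      ∀ (ι κ : Type) (xs : ι → Fin n → ℝ) (zs : κ → Fin n → ℝ), (∀ i j, 0 ≤ xs i j) →
        (∀ k, zs k ∈ hyperbolicityCone P (fun _ => (1 : ℝ))) →
        ∃ (U : ι → Matrix (Fin n) (Fin n) ℝ) (V : κ → Matrix (Fin n) (Fin n) ℝ),
          (∀ i, (U i).PosSemidef) ∧ (∀ k, (V k).PosSemidef) ∧
            ∀ i k, gradForm P (zs k) (xs i) = Matrix.trace (U i * V k) := by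
  intro n r Y hY P hP hpos ι κ xs zs hxs hzs
  have h1ne : MvPolynomial.eval (fun _ => (1 : ℝ)) P ≠ 0 := hpos.ne'
  -- real-rootedness along `x + z𝟙`: the landed support item `PermanentalHyperbolic`
  have hIs : IsHyperbolic P (fun _ => (1 : ℝ)) :=
    ⟨h1ne, fun x z hz => permanentalHyperbolic_proof n r Y hY P hP h1ne x z (by simpa using hz)⟩
  subst hP
  exact stub_orthantRowsFactorSizeN n _ _ (isHomogeneous_rowPermanent Y r) hIs hpos
    (fun j => mem_hyperbolicityCone_rowPermanent_of_nonneg Y r hY h1ne fun j' => by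
      rw [Pi.single_apply]
      split_ifs
      · exact zero_le_one
      · exact le_rfl)
    ι κ xs zs hxs hzs

/-- **Level `c ≥ 1` witnesses need negative coordinates.**  For a nonnegative permanental cone
(`Y ≥ 0`, `P = per[(Y)_{rows<r}; s^{(n-r)}]`, `P(𝟙) > 0`) and cone points `z_k`: if for some size
`m ≥ n` the gradient slack matrix `⟨∇P(z_k), x_i⟩` has NO psd factorisation of size `m`, then some
row point has a negative coordinate (contrapositive of `permanental_orthantRows_factor`, padded from
size `n` to size `m` by `psdFactor_mono`). [folklore] -/
theorem permanental_levelOne_rows_not_all_nonneg :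
    ∀ (n r : ℕ) (Y : Matrix (Fin n) (Fin n) ℝ), (∀ i j, 0 ≤ Y i j) →
      ∀ P : MvPolynomial (Fin n) ℝ, P = (Matrix.of fun i j : Fin n =>
        if (i : ℕ) < r then MvPolynomial.C (Y i j) else MvPolynomial.X j).permanent →
      0 < MvPolynomial.eval (fun _ => (1 : ℝ)) P →
      ∀ (ι κ : Type) (xs : ι → Fin n → ℝ) (zs : κ → Fin n → ℝ),
        (∀ k, zs k ∈ hyperbolicityCone P (fun _ => (1 : ℝ))) →
        ∀ m : ℕ, n ≤ m →
          (¬ ∃ (U : ι → Matrix (Fin m) (Fin m) ℝ) (V : κ → Matrix (Fin m) (Fin m) ℝ),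
            (∀ i, (U i).PosSemidef) ∧ (∀ k, (V k).PosSemidef) ∧
              ∀ i k, gradForm P (zs k) (xs i) = Matrix.trace (U i * V k)) →
          ∃ i j, xs i j < 0 := by
  intro n r Y hY P hP hpos ι κ xs zs hzs m hnm hno
  by_contra! hxs
  exact hno (psdFactor_mono hnm
    (permanental_orthantRows_factor n r Y hY P hP hpos ι κ xs zs hxs hzs))

end Summit.ValiantsHypothesis.ValiantsHypothesis.Theorems.PermanentalConesPermanentalConeHard

end
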